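import Literature.Computability.AlgebraicComplexity.BorderRankMatMulSmallProofs
import Literature.Computability.AlgebraicComplexity.BorderRankMatMulRectangular
import HarnessLib

/-!
# `bR(⟨2,2,5⟩) ≤ 16` (two copies of Alekseev–Smirnov 2013 glued by Landsberg–Ryder 2017, Prop. 3.1): the `n = 5` cell of Smirnov's `R̲(M_⟨2,2,n⟩) ≤ 3n + 1`, proved

Topic `Literature/Computability/AlgebraicComplexity`; companion of `BorderRankMatMul224.lean`
(`bR(⟨2,2,4⟩) ≤ 13`) and of the named fact `Smirnov2013_borderRank_matMulTensor_22n_le`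
(`BorderRankMatMulRectangular.lean`: `R̲(M_⟨2,2,n⟩) ≤ 3n + 1` for `n ≤ 7`, Smirnov 2013 as quoted
by Conner–Harper–Landsberg 2023, p. 4). THIS FILE PROVES THE CASE `n = 5`: `R̲(M_⟨2,2,5⟩) ≤ 16`,
over every field in which `2 ≠ 0`, by a kernel-checked integer certificate for an explicit order-`2`
approximate decomposition of `2·⟨5,2,2⟩` with `16` triads.

## The scheme (Landsberg–Ryder 2017, §3 Prop. 3.1 with `m = m' = 3`; §7)

`T_{BCLRS,3} := M_⟨3,2,2⟩ − x¹₁ ⊗ (y¹₁ ⊗ z¹₁ + y¹₂ ⊗ z²₁)` has `R̲ ≤ 8` (Alekseev–Smirnov 2013,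
Thm. 2; the eight order-`2` triads `p₁,…,p₈` of Landsberg–Ryder §7 = Landsberg 2017 §4.8.2,
coefficients `±1, ±½`; one misprint corrected as recorded in `BorderRankMatMul224.lean`: in `p₁` the
middle term of the first factor is `−½ ε x²₂`). Gluing two copies along a shared row (Prop. 3.1,
`n = 3 + 3 − 1 = 5`), each supplying one of the two entries of that row, gives
`R̲(M_⟨5,2,2⟩) ≤ 16`. Below, the `8 + 8` triads are transported to the tree's
`⟨5,2,2⟩ = matMulTensor K 5 2 2` (a `5 × 2` matrix `A` times a `2 × 2` matrix `B`; slots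
`C = (i,u)`, `A = (i,α)`, `B = (α,u)`, `0`-based): the first block on rows `{2,1,0}` with its missing
entry at `(2,1)`, the second on rows `{2,3,4}` with its missing entry at `(2,0)`; every triad is
doubled in exactly one factor (clearing the halves), so that all coefficients are integers and
`∑ₜ Uₜ ⊗ Vₜ ⊗ Wₜ = 2·ε²·⟨5,2,2⟩ + O(ε³)` (confirmed in exact rational arithmetic before
transcription; the kernel check below is the proof).

## Contents (all proved; the `def`s are coefficient tables and the check program only)

* `AlekseevSmirnov2013.GlueFive.uMats / vMats / wMats`, `…Tab`, `entryPoly`, `rhsZ`, `check522`,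
  `check522_eq_true`, `coeffL_entryPoly`, `uC / vC / wC`, `isApproxDecomposition` — data, finite check
  (`decide +kernel`) and transport to `K[ε]` for a field `K` with `2 ≠ 0`, in the `Smirnov2013.toPoly`
  encoding of `BorderRankMatMulSmallProofs.lean`.
* `approxRank_two_matMulTensor_522_le`, `algBorderRank_matMulTensor_522_le / _225_le / _252_le` —
  **`R₂(⟨5,2,2⟩) ≤ 16`, hence `bR ≤ 16` in the three cyclic formats**.
* `Smirnov2013_borderRank_matMulTensor_22n_le_five` — the case `n = 5` of the named fact, over `ℂ`.

## References

* [AlekseevSmirnov2013] V. B. Alekseev, A. V. Smirnov, Proc. Steklov Inst. Math. 282, Suppl. 1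
  (2013) S123–S139 — Thm. 2, read through Landsberg–Ryder §7.
* [LandsbergRyder2015] J. M. Landsberg, N. Ryder, Exp. Math. 26 (2017) 275–286 = arXiv:1509.08323
  (held) — §2, §3 Prop. 3.1, §7.
* [LandsbergGCT2017] J. M. Landsberg, *Geometry and Complexity Theory*, CUP 2017 (held), §4.8.2,
  Exercise 3.2.2.1.
* [Blaser2013] M. Bläser, *Fast Matrix Multiplication* (2013) — Def. 6.1, Thm. 6.3(1).
-/

noncomputable section

open scoped BigOperators Polynomial
open Polynomial

namespace Literature.Computability.AlgebraicComplexity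

namespace AlekseevSmirnov2013.GlueFive

open Smirnov2013

/-! ## The data: `16` triads for `2·ε²·⟨5,2,2⟩` -/

/-- `Uₜ ∈ ℤ[ε]^{5×2}` (`t = 1,…,16`): the vectors on the product slot `C = (i,u)`; triads `1–8` are
Alekseev–Smirnov's `p₁–p₈` on rows `{2,1,0}`, `9–16` the same on rows `{2,3,4}`.
[cite: LandsbergRyder2015, §7] [cite: AlekseevSmirnov2013, Thm. 2] -/
def uMats : List (Fin 5 → Fin 2 → List ℤ) :=
  [![![[1], []], ![[0, 1], []], ![[], []], ![[], []], ![[], []]],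
    ![![[1], [1]], ![[0, 1], [0, 1]], ![[], []], ![[], []], ![[], []]],
    ![![[], [1]], ![[], []], ![[], []], ![[], []], ![[], []]],
    ![![[1], []], ![[], []], ![[], []], ![[], []], ![[], []]],
    ![![[], [2]], ![[0, 1], [0, 1]], ![[0, 0, -2], []], ![[], []], ![[], []]],
    ![![[], [1]], ![[], [0, 1]], ![[], []], ![[], []], ![[], []]],
    ![![[-1], [1]], ![[], []], ![[], []], ![[], []], ![[], []]],
    ![![[2], []], ![[0, 1], [0, 1]], ![[], [0, 0, 2]], ![[], []], ![[], []]],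
    ![![[], []], ![[], []], ![[], []], ![[0, 1], []], ![[1], []]],
    ![![[], []], ![[], []], ![[], []], ![[0, 1], [0, 1]], ![[1], [1]]],
    ![![[], []], ![[], []], ![[], []], ![[], []], ![[], [1]]],
    ![![[], []], ![[], []], ![[], []], ![[], []], ![[1], []]],
    ![![[], []], ![[], []], ![[0, 0, -2], []], ![[0, 1], [0, 1]], ![[], [2]]],
    ![![[], []], ![[], []], ![[], []], ![[], [0, 1]], ![[], [1]]],
    ![![[], []], ![[], []], ![[], []], ![[], []], ![[-1], [1]]],
    ![![[], []], ![[], []], ![[], [0, 0, 2]], ![[0, 1], [0, 1]], ![[2], []]]]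

/-- `Vₜ ∈ ℤ[ε]^{5×2}`: the vectors on the left-factor slot `A = (i,α)`.
[cite: LandsbergRyder2015, §7] [cite: AlekseevSmirnov2013, Thm. 2] -/
def vMats : List (Fin 5 → Fin 2 → List ℤ) :=
  [![![[0, 0, -1], []], ![[0, -1], [2]], ![[], []], ![[], []], ![[], []]],
    ![![[], []], ![[], [2]], ![[1], []], ![[], []], ![[], []]],
    ![![[0, 0, 2], [0, 2]], ![[0, -1], [-2]], ![[], []], ![[], []], ![[], []]],
    ![![[0, 0, 1], [0, -2]], ![[0, -1], [2]], ![[], []], ![[], []], ![[], []]],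
    ![![[0, 0, -1], []], ![[0, 1], []], ![[-1], []], ![[], []], ![[], []]],
    ![![[], []], ![[0, 1], [2]], ![[], []], ![[], []], ![[], []]],
    ![![[], [0, -2]], ![[], [2]], ![[1], []], ![[], []], ![[], []]],
    ![![[], []], ![[0, 1], []], ![[1], []], ![[], []], ![[], []]],
    ![![[], []], ![[], []], ![[], []], ![[2], [0, -1]], ![[], [0, 0, -1]]],
    ![![[], []], ![[], []], ![[], [1]], ![[2], []], ![[], []]],
    ![![[], []], ![[], []], ![[], []], ![[-2], [0, -1]], ![[0, 2], [0, 0, 2]]],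
    ![![[], []], ![[], []], ![[], []], ![[2], [0, -1]], ![[0, -2], [0, 0, 1]]],
    ![![[], []], ![[], []], ![[], [-1]], ![[], [0, 1]], ![[], [0, 0, -1]]],
    ![![[], []], ![[], []], ![[], []], ![[2], [0, 1]], ![[], []]],
    ![![[], []], ![[], []], ![[], [1]], ![[2], []], ![[0, -2], []]],
    ![![[], []], ![[], []], ![[], [1]], ![[], [0, 1]], ![[], []]]]

/-- `Wₜ ∈ ℤ[ε]^{2×2}`: the vectors on the right-factor slot `B = (α,u)`.
[cite: LandsbergRyder2015, §7] [cite: AlekseevSmirnov2013, Thm. 2] -/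
def wMats : List (Fin 2 → Fin 2 → List ℤ) :=
  [![![[-1], [1]], ![[0, 1], []]],
    ![![[1], [-1]], ![[], []]],
    ![![[1], [1]], ![[], [0, 1]]],
    ![![[1], [1]], ![[0, -1], []]],
    ![![[1], []], ![[], []]],
    ![![[-1], [1]], ![[], [0, 1]]],
    ![![[1], [1]], ![[], []]],
    ![![[], [1]], ![[], []]],
    ![![[0, 1], []], ![[-1], [1]]],
    ![![[], []], ![[1], [-1]]],
    ![![[], [0, 1]], ![[1], [1]]],
    ![![[0, -1], []], ![[1], [1]]],
    ![![[], []], ![[1], []]],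
    ![![[], [0, 1]], ![[-1], [1]]],
    ![![[], []], ![[1], [1]]],
    ![![[], []], ![[], [1]]]]

/-- `Uₜ` indexed by `t : Fin 16`. [cite: LandsbergRyder2015, §7] -/
def uTab (t : Fin 16) : Fin 5 → Fin 2 → List ℤ := uMats.getD t fun _ _ => []

/-- `Vₜ` indexed by `t : Fin 16`. [cite: LandsbergRyder2015, §7] -/
def vTab (t : Fin 16) : Fin 5 → Fin 2 → List ℤ := vMats.getD t fun _ _ => []

/-- `Wₜ` indexed by `t : Fin 16`. [cite: LandsbergRyder2015, §7] -/
def wTab (t : Fin 16) : Fin 2 → Fin 2 → List ℤ := wMats.getD t fun _ _ => []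

/-! ## The finite check -/

/-- The integer polynomial `∑ₜ Uₜ(i,l) Vₜ(j,m) Wₜ(k,n)`: entry `((i,l),(j,m),(k,n))` of
`∑ₜ Uₜ ⊗ Vₜ ⊗ Wₜ`. [cite: LandsbergRyder2015, §3 Prop. 3.1] -/
def entryPoly (i : Fin 5) (l : Fin 2) (j : Fin 5) (m k n : Fin 2) : List ℤ :=
  psum (List.ofFn fun t : Fin 16 => pmul (pmul (uTab t i l) (vTab t j m)) (wTab t k n))

/-- The expected coefficients: `2·ε²·⟨5,2,2⟩`. [cite: LandsbergRyder2015, §3 Prop. 3.1] -/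
def rhsZ (i : Fin 5) (l : Fin 2) (j : Fin 5) (m k n : Fin 2) (d : ℕ) : ℤ :=
  if d = 2 then (if i = j ∧ m = k ∧ l = n then 2 else 0) else 0

/-- The whole finite check: all `10 · 10 · 4` entries, degrees `0, 1, 2`.
[cite: LandsbergRyder2015, §3 Prop. 3.1] -/
def check522 : Bool :=
  (List.finRange 5).all fun i => (List.finRange 2).all fun l => (List.finRange 5).all fun j =>
    (List.finRange 2).all fun m => (List.finRange 2).all fun k => (List.finRange 2).all fun n =>
      (List.range 3).all fun d => coeffL (entryPoly i l j m k n) d == rhsZ i l j m k n d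

/-- The kernel runs the check. [cite: LandsbergRyder2015, §3 Prop. 3.1] -/
theorem check522_eq_true : check522 = true := by
  decide +kernel

/-- Unpacking `check522`: entry by entry, degree by degree. [cite: LandsbergRyder2015, §3 Prop. 3.1] -/
theorem coeffL_entryPoly (i : Fin 5) (l : Fin 2) (j : Fin 5) (m k n : Fin 2) {d : ℕ} (hd : d ≤ 2) :
    coeffL (entryPoly i l j m k n) d = rhsZ i l j m k n d := by
  have h := check522_eq_true
  simp only [check522, List.all_eq_true, beq_iff_eq] at h
  exact h i (List.mem_finRange i) l (List.mem_finRange l) j (List.mem_finRange j)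
    m (List.mem_finRange m) k (List.mem_finRange k) n (List.mem_finRange n) d
    (List.mem_range.2 (by omega))

/-! ## Transport to `K[ε]` -/

section Transport

variable (K : Type*) [Field K]

/-- First vectors `2⁻¹·Uₜ ∈ K[ε]^{5×2}` (slot `C`). [cite: LandsbergRyder2015, §3 Prop. 3.1] -/
def uC (t : Fin 16) (a : Fin 5 × Fin 2) : K[X] := C (2⁻¹ : K) * toPoly (uTab t a.1 a.2)

/-- Second vectors `Vₜ ∈ K[ε]^{5×2}` (slot `A`). [cite: LandsbergRyder2015, §3 Prop. 3.1] -/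
def vC (t : Fin 16) (b : Fin 5 × Fin 2) : K[X] := toPoly (vTab t b.1 b.2)

/-- Third vectors `Wₜ ∈ K[ε]^{2×2}` (slot `B`). [cite: LandsbergRyder2015, §3 Prop. 3.1] -/
def wC (t : Fin 16) (c : Fin 2 × Fin 2) : K[X] := toPoly (wTab t c.1 c.2)

/-- **Two glued Alekseev–Smirnov schemes as an order-`2` approximate decomposition of `⟨5,2,2⟩`
with `16` triads**, over every field with `2 ≠ 0`: `∑ₜ (2⁻¹Uₜ) ⊗ Vₜ ⊗ Wₜ = ε² ⟨5,2,2⟩ + O(ε³)`.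
[cite: LandsbergRyder2015, §3 Prop. 3.1] [cite: AlekseevSmirnov2013, Thm. 2] -/
theorem isApproxDecomposition (h2 : (2 : K) ≠ 0) :
    IsApproxDecomposition 2 (matMulTensor K 5 2 2) (uC K) (vC K) (wC K) := by
  intro a b c d hd
  have hsum : (∑ t, uC K t a * vC K t b * wC K t c) =
      C (2⁻¹ : K) * toPoly (entryPoly a.1 a.2 b.1 b.2 c.1 c.2) := by
    rw [entryPoly, toPoly_psum, List.map_ofFn, List.sum_ofFn, Finset.mul_sum]
    refine Finset.sum_congr rfl fun t _ => ?_
    simp only [Function.comp_apply, toPoly_pmul, uC, vC, wC]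
    ring
  rw [hsum, coeff_C_mul, coeff_toPoly, coeffL_entryPoly _ _ _ _ _ _ hd, rhsZ]
  simp only [matMulTensor]
  split_ifs <;> simp [h2]

end Transport

end AlekseevSmirnov2013.GlueFive

/-! ## The bounds -/

section Bounds

variable (K : Type*) [Field K]

/-- **`R₂(⟨5,2,2⟩) ≤ 16`** over every field with `2 ≠ 0`. [cite: LandsbergRyder2015, §3 Prop. 3.1]
[cite: AlekseevSmirnov2013, Thm. 2] -/
theorem approxRank_two_matMulTensor_522_le (h2 : (2 : K) ≠ 0) :
    approxRank 2 (matMulTensor K 5 2 2) ≤ 16 :=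
  approxRank_le_of_isApproxDecomposition (AlekseevSmirnov2013.GlueFive.isApproxDecomposition K h2)

/-- **`bR(⟨5,2,2⟩) ≤ 16`** over every field with `2 ≠ 0`. [cite: LandsbergRyder2015, §3 Prop. 3.1]
[cite: AlekseevSmirnov2013, Thm. 2] -/
theorem algBorderRank_matMulTensor_522_le (h2 : (2 : K) ≠ 0) :
    algBorderRank (matMulTensor K 5 2 2) ≤ 16 :=
  (algBorderRank_le_approxRank 2 _).trans (approxRank_two_matMulTensor_522_le K h2)

/-- **`bR(⟨2,2,5⟩) ≤ 16`** (the format of the `(2,2)` column tower; cyclic rotation, Bläser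
Thm. 6.3(1)). [cite: LandsbergRyder2015, §3 Prop. 3.1] [cite: AlekseevSmirnov2013, Thm. 2] -/
theorem algBorderRank_matMulTensor_225_le (h2 : (2 : K) ≠ 0) :
    algBorderRank (matMulTensor K 2 2 5) ≤ 16 :=
  (algBorderRank_le_approxRank 2 _).trans
    ((approxRank_matMulTensor_rotate_le K 2 5 2 2).trans (approxRank_two_matMulTensor_522_le K h2))

/-- **`bR(⟨2,5,2⟩) ≤ 16`** (the third cyclic format). [cite: LandsbergRyder2015, §3 Prop. 3.1]
[cite: AlekseevSmirnov2013, Thm. 2] -/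
theorem algBorderRank_matMulTensor_252_le (h2 : (2 : K) ≠ 0) :
    algBorderRank (matMulTensor K 2 5 2) ≤ 16 :=
  (algBorderRank_le_approxRank 2 _).trans
    ((approxRank_matMulTensor_rotate_le K 2 2 2 5).trans
      ((approxRank_matMulTensor_rotate_le K 2 5 2 2).trans (approxRank_two_matMulTensor_522_le K h2)))

end Bounds

/-- **The case `n = 5` of Smirnov's `R̲(M_⟨2,2,n⟩) ≤ 3n + 1`** (named fact
`Smirnov2013_borderRank_matMulTensor_22n_le`), now a theorem over `ℂ`: `bR(⟨2,2,5⟩) ≤ 16`.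
[cite: Smirnov2013, as quoted in ConnerHarperLandsberg2023 §1 p. 4] [cite: AlekseevSmirnov2013, Thm. 2] -/
theorem Smirnov2013_borderRank_matMulTensor_22n_le_five :
    algBorderRank (matMulTensor ℂ 2 2 5) ≤ 3 * 5 + 1 :=
  algBorderRank_matMulTensor_225_le ℂ two_ne_zero

end Literature.Computability.AlgebraicComplexity

end
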